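import Literature.Analysis.ValidatedNumerics.ExpPoly.Eval

/-!
# Exact exp-polynomial algebra over `ℚ`, III: exact definite integrals, the convolution step, tail integrals

Continues `ExpPoly/Eval.lean`.  Three exact operations on exp-polynomials, each a computable function
on the list data structures together with a soundness theorem about real interval integrals
(Mathlib's `∫ x in a..b`), all resting on the antiderivative `Poly.ad` / `Poly.hasDerivAt_ad` of
`ExpPoly/Poly.lean` and the fundamental theorem of calculus (`integral_eq_sub_of_hasDerivAt`):

* `Blk.integ`, `EP.integ L a b : FS` — `∫_a^b L(x) dx` for rational `a, b`, as a formal sum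
  `Σ c e^q` (`EP.eval_integ`);
* the CONVOLUTION STEP `EP.conv f L` — the block sum of `v ↦ ∫_0^v f(v − u) L(u) du` for a
  one-variable exponential sum `f = Σ a e^{κt}` (`EP.eval_conv`), and its iterate `EP.convIter`;
  this is the operation by which iterated integrals over simplices of products of exponentials are
  computed exactly, one variable at a time;
* TAIL INTEGRALS `EP.tailInteg f p b` — the block sum of `σ ↦ ∫_σ^b f(u − σ) p(u) du` (`EP.eval_tailInteg`).

Plus the congruence lemmas (`EP.eval_conv_congr`, `EP.eval_convIter_congr`, `EP.eval_mul_congr`,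
`EP.integ_congr`) that let a kernel-checked canonical-form equation (`EP.eval_eq_of_canon_eq`) be
substituted inside these operations.

Origin: lines 449–491, 528–615, 703–784 of the package file `Dhl42/ClosedForm/ExpPoly.lean` of the
DHL[42,2] certificate (see `ExpPoly/Poly.lean`), where `conv`/`convIter`/`integ`/`tailInteg` compute
the closed forms of the sieve's main terms; declarations unchanged but for the namespace; no number
theory is stated.

## Main definitions (namespace `Literature.Analysis.ValidatedNumerics.ExpPoly`)

* `Blk.integ`, `EP.integ : EP → ℚ → ℚ → FS`.
* `EP.convTerm`, `EP.conv : ES → EP → EP`, `EP.convIter : ES → ℕ → EP → EP`.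
* `EP.tailInteg : ES → Poly → ℚ → EP`.

## Main results

* `Blk.eval_integ`, `EP.eval_integ : FS.eval (integ L a b) = ∫ x in a..b, eval L x`.
* `EP.eval_conv : eval (conv f L) v = ∫ u in 0..v, ES.eval f (v - u) * eval L u`.
* `EP.eval_tailInteg : eval (tailInteg f p b) σ = ∫ u in σ..b, ES.eval f (u - σ) * Poly.eval p u`.
* `EP.convIter_succ'`, `EP.convIter_add`, and the congruence lemmas.

NOT here: improper integrals, non-rational endpoints, any estimate (everything is an identity).

## References

* Fundamental theorem of calculus for continuous integrands on compact intervals (W. Rudin,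
  *Principles of Mathematical Analysis*, 3rd ed., Thm 6.21); `∫ p(u)e^{κu} du` in closed form by
  integration by parts. [folklore]
-/

open Real MeasureTheory intervalIntegral

namespace Literature.Analysis.ValidatedNumerics.ExpPoly

/-! ## Exact definite integrals of blocks -/

namespace Blk

/-- `∫_a^b p(x)e^{κx+θ} dx` as a formal sum: `A(b)e^{κb+θ} − A(a)e^{κa+θ}`. [folklore] -/
def integ (blk : Blk) (a b : ℚ) : FS :=
  let A := Poly.ad blk.κ blk.p
  [(blk.κ * b + blk.θ, Poly.evalQ A b), (blk.κ * a + blk.θ, -Poly.evalQ A a)]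

/-- Soundness of `Blk.integ` (fundamental theorem of calculus with the antiderivative `Poly.ad`):
the formal sum `blk.integ a b` evaluates to `∫_a^b p(x) e^{κx+θ} dx`. [folklore] -/
theorem eval_integ (blk : Blk) (a b : ℚ) :
    FS.eval (blk.integ a b) = ∫ x in (a : ℝ)..b, blk.eval x := by
  have hderiv : ∀ x ∈ Set.uIcc (a : ℝ) b,
      HasDerivAt (fun y => Poly.eval (Poly.ad blk.κ blk.p) y * exp ((blk.κ : ℝ) * y + blk.θ))
        (blk.eval x) x := fun x _ => Poly.hasDerivAt_ad blk.κ blk.θ blk.p x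
  have hint : IntervalIntegrable blk.eval volume (a : ℝ) b :=
    blk.continuous_eval.intervalIntegrable _ _
  rw [integral_eq_sub_of_hasDerivAt hderiv hint]
  simp only [integ, FS.eval_cons, FS.eval_nil, ← Poly.eval_evalQ]
  push_cast
  ring

end Blk

namespace EP

/-- `∫_a^b L(x) dx` as a formal sum. [folklore] -/
def integ (L : EP) (a b : ℚ) : FS := L.flatMap fun blk => blk.integ a b

/-- A block sum is interval-integrable on every `[a, b]` (it is continuous). [folklore] -/
theorem intervalIntegrable_eval (L : EP) (a b : ℝ) : IntervalIntegrable (eval L) volume a b :=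
  (continuous_eval L).intervalIntegrable _ _

/-- Soundness of `EP.integ`: `FS.eval (integ L a b) = ∫_a^b eval L x dx` (blockwise, by additivity
of the integral). [folklore] -/
theorem eval_integ : ∀ (L : EP) (a b : ℚ), FS.eval (integ L a b) = ∫ x in (a : ℝ)..b, eval L x
  | [], a, b => by simp [integ]
  | blk :: L, a, b => by
      have ih := eval_integ L a b
      simp only [integ, List.flatMap_cons, FS.eval_append] at ih ⊢
      rw [ih, Blk.eval_integ]
      have h1 : IntervalIntegrable blk.eval volume (a : ℝ) b := blk.continuous_eval.intervalIntegrable _ _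
      have h2 := intervalIntegrable_eval L (a : ℝ) b
      rw [← integral_add h1 h2]
      rfl

end EP

/-! ## The convolution step -/

namespace EP

/-- The two blocks of `a e^{κ_r v} ∫_0^v p_b(u) e^{(κ_b − κ_r) u + θ_b} du`. [folklore] -/
def convTerm (κr a : ℚ) (b : Blk) : EP :=
  let A := Poly.ad (b.κ - κr) b.p
  [⟨b.κ, b.θ, Poly.smul a A⟩, ⟨κr, b.θ, [-(a * A.headD 0)]⟩]

/-- Soundness of `convTerm`: for one exponential `a e^{κ_r t}` and one block `b`, the two blocks of
`convTerm κ_r a b` evaluate to `∫_0^v a e^{κ_r (v−u)} · b(u) du` (factor `e^{κ_r v}` out, integrate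
`p_b(u) e^{(κ_b−κ_r)u+θ_b}` exactly with `Poly.ad`, evaluate at `u = v` and `u = 0`). [folklore] -/
theorem eval_convTerm (κr a : ℚ) (b : Blk) (v : ℝ) :
    eval (convTerm κr a b) v = ∫ u in (0 : ℝ)..v, (a : ℝ) * exp ((κr : ℝ) * (v - u)) * b.eval u := by
  -- rewrite the integrand as (a e^{κ_r v}) · (p_b(u) e^{(κ_b - κ_r) u + θ_b})
  have hI : (fun u => (a : ℝ) * exp ((κr : ℝ) * (v - u)) * b.eval u) =
      fun u => ((a : ℝ) * exp ((κr : ℝ) * v)) *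
        (Poly.eval b.p u * exp ((((b.κ - κr : ℚ)) : ℝ) * u + b.θ)) := by
    funext u
    have e1 : exp ((κr : ℝ) * (v - u)) = exp ((κr : ℝ) * v) * exp (-((κr : ℝ) * u)) := by
      rw [← exp_add]; ring_nf
    have e2 : exp ((((b.κ - κr : ℚ)) : ℝ) * u + b.θ) =
        exp ((b.κ : ℝ) * u + b.θ) * exp (-((κr : ℝ) * u)) := by
      rw [← exp_add, Rat.cast_sub]; ring_nf
    rw [Blk.eval, e1, e2]; ring
  rw [hI, intervalIntegral.integral_const_mul]
  have hderiv : ∀ u ∈ Set.uIcc (0 : ℝ) v,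
      HasDerivAt (fun y => Poly.eval (Poly.ad (b.κ - κr) b.p) y * exp ((((b.κ - κr : ℚ)) : ℝ) * y + b.θ))
        (Poly.eval b.p u * exp ((((b.κ - κr : ℚ)) : ℝ) * u + b.θ)) u :=
    fun u _ => Poly.hasDerivAt_ad (b.κ - κr) b.θ b.p u
  have hcont : Continuous fun u => Poly.eval b.p u * exp ((((b.κ - κr : ℚ)) : ℝ) * u + b.θ) :=
    (Poly.continuous_eval b.p).mul (continuous_exp.comp (by fun_prop))
  rw [integral_eq_sub_of_hasDerivAt hderiv (hcont.intervalIntegrable _ _)]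
  -- evaluate both sides
  have e3 : exp ((((b.κ - κr : ℚ)) : ℝ) * v + b.θ) =
      exp ((b.κ : ℝ) * v + b.θ) * exp (-((κr : ℝ) * v)) := by
    rw [← exp_add, Rat.cast_sub]; ring_nf
  have e4 : exp ((((b.κ - κr : ℚ)) : ℝ) * 0 + b.θ) = exp (b.θ : ℝ) := by simp
  have e5 : exp ((κr : ℝ) * v + b.θ) = exp ((κr : ℝ) * v) * exp (b.θ : ℝ) := exp_add _ _
  have hE : exp ((κr : ℝ) * v) * exp (-((κr : ℝ) * v)) = 1 := by rw [← exp_add]; simp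
  rw [e3, e4, Poly.eval_zero_eq_headD]
  simp only [convTerm, eval_cons, eval_nil, Blk.eval, Poly.eval_smul, Poly.eval_cons, Poly.eval_nil]
  rw [e5]
  push_cast
  linear_combination
    (-((a : ℝ) * Poly.eval (Poly.ad (b.κ - κr) b.p) v * exp ((b.κ : ℝ) * v + b.θ))) * hE

/-- The convolution step: `v ↦ ∫_0^v f(v - u) L(u) du` as a block sum. [folklore] -/
def conv (f : ES) (L : EP) : EP :=
  merge (f.flatMap fun ka => L.flatMap fun b => convTerm ka.1 ka.2 b)

/-- The convolution of one exponential `a e^{κ_r t}` with a block SUM, blockwise: `Σ_b convTerm`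
evaluates to `∫_0^v a e^{κ_r(v−u)} · eval L u du`. [folklore] -/
theorem eval_conv_inner (κr a : ℚ) : ∀ (L : EP) (v : ℝ),
    eval (L.flatMap fun b => convTerm κr a b) v =
      ∫ u in (0 : ℝ)..v, (a : ℝ) * exp ((κr : ℝ) * (v - u)) * eval L u
  | [], v => by simp
  | b :: L, v => by
      rw [List.flatMap_cons, eval_append, eval_conv_inner κr a L v, eval_convTerm]
      have hc : Continuous fun u => (a : ℝ) * exp ((κr : ℝ) * (v - u)) := by fun_prop
      have h1 : IntervalIntegrable (fun u => (a : ℝ) * exp ((κr : ℝ) * (v - u)) * b.eval u) volume 0 v :=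
        (hc.mul b.continuous_eval).intervalIntegrable _ _
      have h2 : IntervalIntegrable (fun u => (a : ℝ) * exp ((κr : ℝ) * (v - u)) * eval L u) volume 0 v :=
        (hc.mul (continuous_eval L)).intervalIntegrable _ _
      rw [← integral_add h1 h2]
      congr 1; funext u; rw [eval_cons]; ring

/-- The convolution of an exponential sum `f` with a block sum `L` before merging equal keys: the
double `flatMap` evaluates to `∫_0^v f(v−u) · eval L u du`. [folklore] -/
theorem eval_conv_raw : ∀ (f : ES) (L : EP) (v : ℝ),
    eval (f.flatMap fun ka => L.flatMap fun b => convTerm ka.1 ka.2 b) v =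
      ∫ u in (0 : ℝ)..v, ES.eval f (v - u) * eval L u
  | [], L, v => by simp
  | ka :: f, L, v => by
      rw [List.flatMap_cons, eval_append, eval_conv_raw f L v, eval_conv_inner]
      have h1 : IntervalIntegrable (fun u => (ka.2 : ℝ) * exp ((ka.1 : ℝ) * (v - u)) * eval L u)
          volume 0 v := by
        apply Continuous.intervalIntegrable
        exact (by fun_prop : Continuous fun u => (ka.2 : ℝ) * exp ((ka.1 : ℝ) * (v - u))).mul
          (continuous_eval L)
      have h2 : IntervalIntegrable (fun u => ES.eval f (v - u) * eval L u) volume 0 v := by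
        apply Continuous.intervalIntegrable
        exact ((ES.continuous_eval f).comp (by fun_prop)).mul (continuous_eval L)
      rw [← integral_add h1 h2]
      congr 1; funext u; rw [ES.eval_cons]; ring

/-- Soundness of the convolution step. [folklore] -/
theorem eval_conv (f : ES) (L : EP) (v : ℝ) :
    eval (conv f L) v = ∫ u in (0 : ℝ)..v, ES.eval f (v - u) * eval L u := by
  unfold conv; rw [eval_merge, eval_conv_raw]

/-- Iterated convolution with the same one-variable factor. [folklore] -/
def convIter (f : ES) : ℕ → EP → EP
  | 0, L => L
  | n + 1, L => convIter f n (conv f L)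

end EP

namespace EP

/-! ### Congruence of the convolution step under equality of denotations -/

/-- The convolution step respects equality of denotations in its block-sum argument. [folklore] -/
theorem eval_conv_congr (f : ES) {L M : EP} (h : eval L = eval M) : eval (conv f L) = eval (conv f M) := by
  funext v; rw [eval_conv, eval_conv, h]

/-- `convIter f (n+1) L = conv f (convIter f n L)` (the iteration unfolded on the outside).
[folklore] -/
theorem convIter_succ' (f : ES) : ∀ (n : ℕ) (L : EP), convIter f (n + 1) L = conv f (convIter f n L)
  | 0, L => rfl
  | n + 1, L => by
      show convIter f (n + 1) (conv f L) = conv f (convIter f (n + 1) L)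
      rw [convIter_succ' f n (conv f L)]; rfl

/-- `convIter f (m+n) = convIter f m ∘ convIter f n`. [folklore] -/
theorem convIter_add (f : ES) : ∀ (m n : ℕ) (L : EP), convIter f (m + n) L = convIter f m (convIter f n L)
  | m, 0, L => rfl
  | m, n + 1, L => by
      show convIter f (m + n) (conv f L) = convIter f m (convIter f n (conv f L))
      exact convIter_add f m n (conv f L)

/-- Iterated convolution respects equality of denotations. [folklore] -/
theorem eval_convIter_congr (f : ES) : ∀ (n : ℕ) {L M : EP}, eval L = eval M →
    eval (convIter f n L) = eval (convIter f n M)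
  | 0, _, _, h => h
  | n + 1, _, _, h => eval_convIter_congr f n (eval_conv_congr f h)

/-- The product of block sums respects equality of denotations in both arguments. [folklore] -/
theorem eval_mul_congr {L L' M M' : EP} (hL : eval L = eval L') (hM : eval M = eval M') :
    eval (mul L M) = eval (mul L' M') := by
  funext x; rw [eval_mul, eval_mul, hL, hM]

/-- The exact definite integral respects equality of denotations. [folklore] -/
theorem integ_congr {L M : EP} (h : eval L = eval M) (a b : ℚ) :
    FS.eval (integ L a b) = FS.eval (integ M a b) := by
  rw [eval_integ, eval_integ, h]

/-! ### Tail integrals `σ ↦ ∫_σ^b f(u − σ) p(u) du` (the weights of the `J^K` part) -/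

/-- `σ ↦ ∫_σ^b f(u − σ) p(u) du` for `f = Σ a e^{κ t}` as a block sum:
`Σ_r [a_r B_r(b) e^{−κ_r σ + κ_r b} − a_r B_r(σ)]`, `B_r = ad κ_r p`. [folklore] -/
def tailInteg (f : ES) (p : Poly) (b : ℚ) : EP :=
  f.flatMap fun ka =>
    [⟨-ka.1, ka.1 * b, [ka.2 * Poly.evalQ (Poly.ad ka.1 p) b]⟩, ⟨0, 0, Poly.smul (-ka.2) (Poly.ad ka.1 p)⟩]

/-- The tail integral against ONE exponential: the two blocks `a·B(b)·e^{−κσ+κb}` and `−a·B(σ)`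
(`B = ad κ p`) evaluate to `∫_σ^b a e^{κ(u−σ)} p(u) du` as a function of `σ`. [folklore] -/
theorem eval_tailInteg_one (κ a : ℚ) (p : Poly) (b : ℚ) (σ : ℝ) :
    eval [⟨-κ, κ * b, [a * Poly.evalQ (Poly.ad κ p) b]⟩, ⟨0, 0, Poly.smul (-a) (Poly.ad κ p)⟩] σ =
      ∫ u in σ..(b : ℝ), (a : ℝ) * exp ((κ : ℝ) * (u - σ)) * Poly.eval p u := by
  have hI : (fun u => (a : ℝ) * exp ((κ : ℝ) * (u - σ)) * Poly.eval p u) =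
      fun u => ((a : ℝ) * exp (-((κ : ℝ) * σ))) * (Poly.eval p u * exp ((κ : ℝ) * u + ((0 : ℚ) : ℝ))) := by
    funext u
    have e1 : exp ((κ : ℝ) * (u - σ)) = exp (-((κ : ℝ) * σ)) * exp ((κ : ℝ) * u + ((0 : ℚ) : ℝ)) := by
      rw [← exp_add]; push_cast; ring_nf
    rw [e1]; ring
  rw [hI, intervalIntegral.integral_const_mul]
  have hderiv : ∀ u ∈ Set.uIcc σ (b : ℝ),
      HasDerivAt (fun y => Poly.eval (Poly.ad κ p) y * exp ((κ : ℝ) * y + ((0 : ℚ) : ℝ)))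
        (Poly.eval p u * exp ((κ : ℝ) * u + ((0 : ℚ) : ℝ))) u :=
    fun u _ => Poly.hasDerivAt_ad κ 0 p u
  have hcont : Continuous fun u => Poly.eval p u * exp ((κ : ℝ) * u + ((0 : ℚ) : ℝ)) :=
    (Poly.continuous_eval p).mul (continuous_exp.comp (by fun_prop))
  rw [integral_eq_sub_of_hasDerivAt hderiv (hcont.intervalIntegrable _ _)]
  simp only [eval_cons, eval_nil, Blk.eval, Poly.eval_smul, Poly.eval_cons, Poly.eval_nil,
    ← Poly.eval_evalQ]
  push_cast
  simp only [add_zero, mul_zero, zero_mul, exp_zero, mul_one]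
  have e2 : exp (-(κ : ℝ) * σ + (κ : ℝ) * b) = exp (-((κ : ℝ) * σ)) * exp ((κ : ℝ) * b) := by
    rw [← exp_add]; ring_nf
  have e4 : exp (-((κ : ℝ) * σ)) * exp ((κ : ℝ) * σ) = 1 := by rw [← exp_add]; simp
  rw [e2]
  linear_combination ((a : ℝ) * Poly.eval (Poly.ad κ p) σ) * e4

/-- Soundness of `tailInteg`: `eval (tailInteg f p b) σ = ∫_σ^b f(u−σ) · p(u) du` for every real `σ`
(termwise over the exponentials of `f`). [folklore] -/
theorem eval_tailInteg : ∀ (f : ES) (p : Poly) (b : ℚ) (σ : ℝ),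
    eval (tailInteg f p b) σ = ∫ u in σ..(b : ℝ), ES.eval f (u - σ) * Poly.eval p u
  | [], p, b, σ => by simp [tailInteg]
  | ka :: f, p, b, σ => by
      have ih := eval_tailInteg f p b σ
      simp only [tailInteg, List.flatMap_cons] at ih ⊢
      rw [eval_append, ih, eval_tailInteg_one]
      have h1 : IntervalIntegrable (fun u => (ka.2 : ℝ) * exp ((ka.1 : ℝ) * (u - σ)) * Poly.eval p u)
          volume σ b :=
        ((by fun_prop : Continuous fun u => (ka.2 : ℝ) * exp ((ka.1 : ℝ) * (u - σ))).mul
          (Poly.continuous_eval p)).intervalIntegrable _ _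
      have h2 : IntervalIntegrable (fun u => ES.eval f (u - σ) * Poly.eval p u) volume σ b :=
        (((ES.continuous_eval f).comp (by fun_prop)).mul (Poly.continuous_eval p)).intervalIntegrable _ _
      rw [← integral_add h1 h2]
      congr 1; funext u; rw [ES.eval_cons]; ring

end EP

end Literature.Analysis.ValidatedNumerics.ExpPoly
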